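import Literature.Barriers.Parity.SiegelZeroQuadraticPolynomials
import HarnessLib

/-!
# Inputs for Granville–Mollin's Theorem 4 (`Literature.Barriers.Parity.GranvilleMollin2000_thm4`): the two
# exceptional-prime sparsity estimates of *Rabinowitsch revisited*, §5C

Topic `Literature/Barriers/Parity`, companion of `SiegelZeroQuadraticPolynomials.lean` (the
catalogue entry vendoring Granville–Mollin, *Rabinowitsch revisited*, Acta Arith. 96 (2000),
Theorem 4: under a Siegel zero `β = 1 − 1/(η log|d|)` of `L(s, (d/·))` with `η ≥ log|d|`,
`π_{f_d}(N) ∼ ϱ_d N` uniformly for `|d|^{10} ≤ N ≤ |d|^{o(η)}`, `f_d = x² + x + (1 − d)/4`).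

The printed proof of Theorem 4 (§6A–6B) is a sieve argument (the fundamental lemma of the sieve,
PROVED in this tree: `Literature.NumberTheory.Sieve.SieveSequence.fundamental_lemma_uniform_holds`,
`Literature/NumberTheory/Sieve/SieveFrameworkFundamentalLemma.lean`) fed by exactly two analytic
estimates on the sparsity of the primes `p` with `ω(p) = ω_{f_d}(p) > 0` (the primes dividing some
value of `f_d`; `ω(p) = 1 + (d/p)`, §5 (5.1) with `a = 1`), both consequences of the Siegel zero.
This file vendors these two inputs as named facts, AS PRINTED in §5C and in the form (`ω`-weights)
in which §6B consumes them; the assembly of Theorem 4 from them is carried out in the sibling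
`SiegelZeroQuadraticPolynomialsProofs.lean`.

## What the source prints (Acta Arith. 96 (2000), pp. 145–150; verified on the page)

[cite: GranvilleMollin2000, §3 (3.1)–(3.3), §5 (5.1), §5C (5.4)–(5.8)]
* §3, p. 145–146: (3.1) the explicit formula "for `x ≥ T ≥ |d| ≥ 1` where `d` is not a square,
  `∑_{p ≤ x} (d/p) log p + x^β/β ≪ x log² x / T + x^{1/2} + ∑_{|γ| < T} x^{Re ϱ}`, where the
  `x^β/β` occurs only if there is a Siegel zero `β`" [Davenport, §19 (13)–(14)]; (3.2) "for fixed
  `C > 9`, there exists a small constant `c > 0` such that if `x ≥ T^C` then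
  `∑_{|d| ≤ T} ∑_{|γ| < T} x^{Re ϱ} ≪ x^{1/2} T³ + δ x^{1 − c/log T}`, where `δ = (1 − β) log T` if
  there is a Siegel zero, and `δ = 1` otherwise. Here we sum over the zeros of `L(s, (d/·))`, with
  `d` squarefree, and of `ζ(s)` when `d = 1`" [Bombieri, *Le grand crible*, pp. 54–55]; (3.3) "Fix
  `C > 9`. … for `x > |d|^C`, `∑_{p ≤ x} (d/p) log p + x^β/β ≪ x/(|d| log x) + x^{1−c/log|d|}/η`."
* p. 142 (standing convention): "`L(σ + it, χ) ≠ 0` for `σ ≥ 1 − c/log(q(|t| + 2))` (for some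
  explicit `c > 0`), except possibly when `χ` is real and `t = 0`. These are the "Siegel zeros" …
  we shall denote this zero by `β` if it exists, and assume `η := 1/((1 − β) log q) ≥ 3` (and we
  know that `η ≪ q`)."
* §5, p. 148–149: (5.1) "`ω(p) = 1 + (d/p)` if `p` does not divide `a`" (here `a = 1`).
* §5C, p. 149–150: "**If `d^η > x ≥ d^C` then by (3.3) and (3.2) (where we sum over the zeros of
  `ζ(s)`) we get `∑_{p ≤ x} (1 + (d/p)) log p ≪ x − x^β/β + x/(|d| log x) + x^{1−c/log|d|}/η
  ≪ x log x / log(d^η)`.** By partial summation we obtain for `d^η > x > y ≥ d^C`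
  (5.5) `∏_{y < p ≤ x} (1 − (1 + (d/p))/p) = 1 + O(log x / log(d^η))`." … "**In Lemma 3 of [11]
  [Heath-Brown, *Prime twins and Siegel zeros*] it is shown that
  `∑_{p ≤ d^{500}} (1 + (d/p)) (log p)/p ≪ log d/√(log η)`, and so
  `∑_{p ≤ d^{500}} ω(p) (log p)/p ≪ log d/√(log η)`.** Taking `y = d^{10}` gives (5.6)
  `∏_{z < p ≤ y} (1 − ω(p)/p) = 1 + O(log d/(log z √(log η)))`." (5.7), (5.8) follow.
* Tao–Teräväinen, *The Hardy–Littlewood–Chowla conjecture in the presence of a Siegel zero*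
  (2022), §3.3 (3.11), restate Heath-Brown's Lemma 3 in the same form: "in [Heath-Brown] it was
  shown that `∑_{p* ≤ q_χ^{500}} log p*/p* ≪ log q_χ/√(log η)`" (`p*` the primes with
  `χ(p*) ≠ −1`; their Definition 1.4: `β` real, `L(β, χ) = 0`, `χ` primitive quadratic of conductor
  `q_χ`, `β = 1 − 1/(η log q_χ)` with `η ≥ 10`), and prove the stronger Proposition 3.5 by an
  elementary argument. [cite: TaoTeravainen2021, §3.3 (3.11), Definition 1.4 and Proposition 3.5]

## The two named facts

* `GranvilleMollin2000_eq5_5'` — the displayed estimate of §5C preceding (5.5) (from which (5.5)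
  follows by partial summation), for the monic family `f_d` with `ω = 1 + (d/·)`:
  for fixed `C > 9`, `∑_{p ≤ x} ω_{f_d}(p) log p ≪_C x log x/(η log|d|)` whenever
  `|d|^C ≤ x < |d|^η` and `L(s, (d/·))` has the Siegel zero `β = 1 − 1/(η log|d|)`;
* `GranvilleMollin2000_heathBrownLemma3` — Heath-Brown's Lemma 3 in the `ω`-form printed in §5C:
  `∑_{p ≤ |d|^{500}} ω_{f_d}(p) (log p)/p ≪ log|d|/√(log η)` under the same hypothesis.

Both are consequences of a real zero very close to `1` (in print: the first via the explicit
formula with the Deuring–Heilbronn phenomenon, (3.1)–(3.3); the second is [Heath-Brown 1983,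
Lemma 3]); the printed route (explicit formula, log-free zero-density estimates) is not available in
Mathlib.

**Status (barrier audit, 2026-08-16): both facts are THEOREMS of this tree**, with axioms
`{propext, Classical.choice, Quot.sound}`, by elementary routes that avoid the explicit formula:
* `GranvilleMollin2000_eq5_5'_holds` (`SiegelZeroQuadraticPolynomialsInputsProofs.lean`): Siegel's
  theorem `1 − β ≥ C₀ q^{−1/4}` (so `η log q ≤ q^{1/4}/C₀`), the bound
  `L(1, χ) ∏_{p < z} (1 − 1/p)(1 − χ(p)/p) ≪ 1/(η log q)` at `z = q^{1/10}` obtained from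
  `L(β, χ) = 0`, and the dimension-`2` upper-bound sieve on `r = 1 ∗ χ`; it takes `η₀ = 3`,
  `d₀ = 1024`, and does NOT use the upper constraint `x < |d|^η` (kept in the statement as printed);
* `GranvilleMollin2000_heathBrownLemma3_holds` (`SiegelZeroQuadraticPolynomialsHeathBrown.lean`):
  from Tao–Teräväinen's Proposition 3.5, both bounds of which are proved in the tree
  (`TaoTeravainen2021_eq313_holds`, `Literature/NumberTheory/LFunctions/SiegelZeroExceptionalPrimesProofs.lean`;
  `TaoTeravainen2021_eq314_holds`, `…/SiegelZeroExceptionalPrimesSecond.lean`), exactly as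
  Tao–Teräväinen indicate after their restatement of Heath-Brown's Lemma 3 (numbered (3.11) in the
  numbering used throughout this tree; it is (3.20), and Proposition 3.5's bounds are (3.22)–(3.23),
  in the arXiv text held by the literature store; their footnote: Heath-Brown's lemma controls the
  primes with `χ(p) = 1`, and the primes `p ∣ q` with `χ(p) = 0` — weight `ω(p) = 1` here — are
  easily added).
Consequently the target `GranvilleMollin2000_thm4` and the catalogued barrier
`SiegelZeroQuadraticPolynomials` are unconditional theorems of the tree
(`SiegelZeroQuadraticPolynomialsTheorem4Holds.lean`, `SiegelZeroQuadraticPolynomialsHolds.lean`).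
The audit found nothing to narrow: the statements are restrictions (to `a = 1`, `d < 0` fundamental,
`d ≡ 1 (mod 4)`) of the printed ones, and the later literature is consistent with them and sharper —
Tao–Teräväinen's Proposition 3.5 (saving `1/η` in place of `1/√(log η)`), and the extension of the
phenomenon of Theorem 4 to every quadratic `f = ax² + bx + c` of exceptional discriminant `Δ`,
the exceptionality measured by `β = −log(L(1, χ_Δ) log|Δ|)`: with `π_f(N) = #{0 ≤ f(n) ≤ N prime}`,
`A = #𝒜`, `𝒜 = {f(n) ∈ [0, N] : n ∈ ℤ}`, and `V(A) = ∏_{p < A} (1 − ρ(p)/p)`, one has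
`π_f(N) = A V(A) (1 + O(e^{−√β/6}))` for `1 ≤ |a| ≤ e^{β/5}` and `g(Δ) ≤ N ≤ |a||Δ|^{β/2}`
(an asymptotic only along `β → ∞`) [cite: ChamizoJimenezurroz2021, Theorem 1.1 and Remark 1.2].

## Design notes

* Hypotheses are those of the target `GranvilleMollin2000_thm4` (same file conventions): `d` a
  negative fundamental discriminant `≡ 1 (mod 4)` (`IsNegFundOne d`), `(d/·)` rendered as "the
  primitive quadratic Dirichlet character `χ` mod `q = |d|`" (a singleton class), the zero as
  `χ.LFunction (1 − 1/(η log|d|)) = 0`, and `ω(p) = Literature.polyRootCountMod ![rabinowitschPoly d] p`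
  (for `f_d`, `a = 1`, so `ω(p) = 1 + (d/p)` for every prime `p` by (5.1), including `p = 2` and
  `p ∣ d`). Restricting the printed statements (valid for all squarefree `d`) to this family only
  weakens them.
* "`β` is the Siegel zero" (p. 142: `β > 1 − c/log q` for the explicit zero-free constant `c`, and
  `η ≥ 3`) is implied by `η ≥ η₀` for a suitable absolute `η₀ = max(3, 2/c)`; the facts therefore
  quantify `∃ η₀` (together with the implied constant `K` and a threshold `d₀` on `|d|`, which again
  only weakens them). The target theorem has `η ≥ log|d| → ∞`, so any `η₀` is admissible there.
* The upper limit `x < |d|^η` of the first display is kept as printed (strict).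
-/

noncomputable section

open Finset

namespace Literature.Barriers.Parity

/-- **Granville–Mollin 2000, §5C, the display preceding (5.5)** (consequence of the explicit
formula (3.1) and Bombieri's zero-density estimate with the Deuring–Heilbronn factor (3.2), via
(3.3)), for the family `f_d = x² + x + (1 − d)/4`, where `ω_{f_d}(p) = 1 + (d/p)` ((5.1), `a = 1`):
for every fixed `C > 9` there are `K`, `η₀`, `d₀` such that for every negative fundamental
`d ≡ 1 (mod 4)` with `|d| ≥ d₀`, every real zero `β = 1 − 1/(η log|d|)` of `L(s, (d/·))` with
`η ≥ η₀` (a Siegel zero in the sense of p. 142), and every `x` with `|d|^C ≤ x < |d|^η`: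
`∑_{p ≤ x} ω_{f_d}(p) log p ≤ K x log x / (η log|d|)` ("`≪ x log x / log(d^η)`").
[cite: GranvilleMollin2000, §5C (display before (5.5)), with (3.3) and (5.1)] -/
def GranvilleMollin2000_eq5_5' : Prop :=
  ∀ C : ℝ, 9 < C → ∃ K η₀ d₀ : ℝ, ∀ d : ℤ, IsNegFundOne d → d₀ ≤ |(d : ℝ)| →
    ∀ (q : ℕ) [NeZero q], (q : ℤ) = |d| → ∀ χ : DirichletCharacter ℂ q, χ.IsPrimitive →
      χ.IsQuadratic → ∀ η : ℝ, η₀ ≤ η →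
        χ.LFunction ((1 - 1 / (η * Real.log |(d : ℝ)|) : ℝ) : ℂ) = 0 →
          ∀ x : ℝ, (|(d : ℝ)|) ^ C ≤ x → x < (|(d : ℝ)|) ^ η →
            ∑ p ∈ Nat.primesLE ⌊x⌋₊, (Literature.NumberTheory.Sieve.polyRootCountMod ![rabinowitschPoly d] p : ℝ) * Real.log p ≤
              K * (x * Real.log x / (η * Real.log |(d : ℝ)|))

/-- **Heath-Brown 1983, Lemma 3, in the form printed by Granville–Mollin 2000, §5C** (the display
following "(log p)/p ≪ log d/√(log η)"; also Tao–Teräväinen 2022, (3.11)): there are `K`, `η₀`,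
`d₀` such that for every negative fundamental `d ≡ 1 (mod 4)` with `|d| ≥ d₀` and every real zero
`β = 1 − 1/(η log|d|)` of `L(s, (d/·))` with `η ≥ η₀`:
`∑_{p ≤ |d|^{500}} ω_{f_d}(p) (log p)/p ≤ K log|d| / √(log η)`, `ω_{f_d}(p) = 1 + (d/p)`.
[cite: GranvilleMollin2000, §5C (display before (5.6))] [cite: Heathbrown1983, Lemma 3 (as quoted in GranvilleMollin2000 §5C and TaoTeravainen2021 (3.11))] -/
def GranvilleMollin2000_heathBrownLemma3 : Prop :=
  ∃ K η₀ d₀ : ℝ, ∀ d : ℤ, IsNegFundOne d → d₀ ≤ |(d : ℝ)| →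
    ∀ (q : ℕ) [NeZero q], (q : ℤ) = |d| → ∀ χ : DirichletCharacter ℂ q, χ.IsPrimitive →
      χ.IsQuadratic → ∀ η : ℝ, η₀ ≤ η →
        χ.LFunction ((1 - 1 / (η * Real.log |(d : ℝ)|) : ℝ) : ℂ) = 0 →
          ∑ p ∈ Nat.primesLE ⌊(|(d : ℝ)|) ^ (500 : ℝ)⌋₊,
              (Literature.NumberTheory.Sieve.polyRootCountMod ![rabinowitschPoly d] p : ℝ) * Real.log p / p ≤
            K * (Real.log |(d : ℝ)| / Real.sqrt (Real.log η))

end Literature.Barriers.Parity
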